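import Literature.Probability.Percolation.AdjCorridorCatch
import HarnessLib

/-!
# The near-side tubes of the two corridor systems of a fenced exit

Topic `Literature/Probability/Percolation`; family `crit-perc` / near-critical percolation on `𝕋`.
A brick of the near-critical arm-separation theorem for four arms in the ADJACENT colour
arrangement (P. Nolin, EJP 13 (2008), Thm. 11, `j = 4`, `σ = BBWW` [arXiv 0711.4948: Thm. 10]),
landing step for two arms of one colour (frame of the exit's side; tip `z = (2M, t)`, scale `k`).
The two corridor systems of an exit of type `A` (fence above the tip) start with

* system `α`: the tall catch tube `nearTubeA M t k = [2M + 1, 2M + k - 2] × [t + 1, t + 3k]`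
  (vertical; its crossings cross `catchTubeA` in their lower part, hence meet the connection of the
  fence: `TermFence.nearA_meets`) followed by a THIN spoke
  `spokeTubeA M t k b L = [2M + 1, 2M + 1 + L] × [b, b + h]` with `[b, b + h] ⊆ [t + 2k + 2, t + 3k]`
  (`crosses_nearTubeA_spokeTubeA`: thin horizontal through fat vertical);
* system `β`: a thin spoke `spokeTubeB M t k b L = [2M + k, 2M + k + L] × [b, b + h]` with
  `[b, b + h] ⊆ [t + 1, t + k - 1]`, whose crossings cross `catchTubeB` first, hence meet the lower
  branch of the tall fence crossing (`TermFenceT.spokeB_meets`);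

all inside the rows `(t, t + 3k]` (`rows_near_A`), the `α`-tubes and the `β`-tube pairwise disjoint
(`disjoint_near_A`). Mirrors below the tip for exits of type `B` are stated alike
(`nearTubeA'`, `spokeTubeA'`, `spokeTubeB'`, …). Everything here is proved.

## References

* P. Nolin, Near-critical percolation in two dimensions, *Electron. J. Probab.* 13 (2008), §4.3
  Prop. 12 (proof) (arXiv 0711.4948: Prop. 11) [Nolin2008].
* H. Kesten, *Percolation theory for mathematicians* (1982), §2.2 [KestenPTM1982].
-/

noncomputable section

open Set

namespace Literature.Probability.Percolation

open LatticeModels Tube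

/-! ### The tubes (type `A`: above the tip) -/

/-- **The tall catch tube of system `α`**: vertical, `[2M + 1, 2M + k - 1] × [t + 1, t + 3k]`. [cite: Nolin2008, §4.3 Prop. 12 (proof) (arXiv 0711.4948: Prop. 11)] -/
def nearTubeA (M : ℕ) (t : ℤ) (k : ℕ) : Tube := ⟨2 * (M : ℤ) + 1, t + 1, k - 2, 3 * k - 1, false⟩

/-- **The spoke of system `α`**: horizontal, `[2M + 1, 2M + 1 + L] × [b, b + h]`. [cite: Nolin2008, §4.3 Prop. 12 (proof) (arXiv 0711.4948: Prop. 11)] -/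
def spokeTubeA (M : ℕ) (b : ℤ) (L h : ℕ) : Tube := ⟨2 * (M : ℤ) + 1, b, L, h, true⟩

/-- **The spoke of system `β`**: horizontal, `[2M + k, 2M + k + L] × [b, b + h]`. [cite: Nolin2008, §4.3 Prop. 12 (proof) (arXiv 0711.4948: Prop. 11)] -/
def spokeTubeB (M : ℕ) (k : ℕ) (b : ℤ) (L h : ℕ) : Tube := ⟨2 * (M : ℤ) + k, b, L, h, true⟩

/-- The thin spoke crosses the tall catch tube (plus sign), when its rows lie inside
`[t + 1, t + 3k]` and it is at least `k - 2` long. [folklore] -/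
theorem crosses_nearTubeA_spokeTubeA {M : ℕ} {t b : ℤ} {k L h : ℕ} (hk : 2 ≤ k) (hL : k - 2 ≤ L)
    (hb : t + 1 ≤ b) (hbh : b + h ≤ t + 3 * k) :
    Crosses (nearTubeA M t k) (spokeTubeA M b L h) := by
  right
  refine ⟨rfl, rfl, ?_, ?_, ?_, ?_⟩ <;> simp only [nearTubeA, spokeTubeA] <;> omega

/-- Aspect ratio of the tall catch tube: at most `7` for `k ≥ 3` (`(3k - 1) ≤ 7 (k - 2)` needs `k ≥ 3`;
we ask `k ≥ 4`). [folklore] -/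
theorem aspectLE_nearTubeA (M : ℕ) (t : ℤ) {k : ℕ} (hk : 4 ≤ k) : (nearTubeA M t k).AspectLE 7 := by
  unfold AspectLE nearTubeA; simp only [cond_false]; omega

/-- Aspect ratio of a spoke of length `L ≤ ρ h`, `1 ≤ h`. [folklore] -/
theorem aspectLE_spokeTubeA (M : ℕ) (b : ℤ) {L h ρ : ℕ} (hh : 1 ≤ h) (hL : L ≤ ρ * h) : (spokeTubeA M b L h).AspectLE ρ := by
  unfold AspectLE spokeTubeA; simp only [cond_true]; exact ⟨hL, hh⟩

/-- Aspect ratio of the `β`-spoke. [folklore] -/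
theorem aspectLE_spokeTubeB (M k : ℕ) (b : ℤ) {L h ρ : ℕ} (hh : 1 ≤ h) (hL : L ≤ ρ * h) : (spokeTubeB M k b L h).AspectLE ρ := by
  unfold AspectLE spokeTubeB; simp only [cond_true]; exact ⟨hL, hh⟩

/-- **Rows of the near tubes**: all three boxes lie in the rows `(t, t + 3k]` and the columns `> 2M`. [folklore] -/
theorem rows_near_A {M : ℕ} {t bα bβ : ℤ} {k Lα Lβ h : ℕ} (hk : 2 ≤ k)
    (hbα : t + 2 * k + 2 ≤ bα) (hbαh : bα + h ≤ t + 3 * k) (hbβ : t + 1 ≤ bβ) (hbβh : bβ + h ≤ t + k - 1) {v : Site 2}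
    (hv : v ∈ (nearTubeA M t k).box ∪ (spokeTubeA M bα Lα h).box ∪ (spokeTubeB M k bβ Lβ h).box) :
    t < v 1 ∧ v 1 ≤ t + 3 * k ∧ 2 * (M : ℤ) < v 0 := by
  rcases hv with (hv | hv) | hv <;> rw [Tube.mem_box] at hv
  · simp only [nearTubeA] at hv; omega
  · simp only [spokeTubeA] at hv; omega
  · simp only [spokeTubeB] at hv; omega

/-- **The `α`-tubes avoid the `β`-spoke**: the catch tube has columns `< 2M + k ≤` those of the
`β`-spoke, and the `α`-spoke has rows `≥ t + 2k + 2 >` those of the `β`-spoke. [folklore] -/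
theorem disjoint_near_A {M : ℕ} {t bα bβ : ℤ} {k Lα Lβ h : ℕ} (hk : 2 ≤ k)
    (hbα : t + 2 * k + 2 ≤ bα) (hbβh : bβ + h ≤ t + k - 1) :
    Disjoint ((nearTubeA M t k).box ∪ (spokeTubeA M bα Lα h).box) (spokeTubeB M k bβ Lβ h).box := by
  rw [Set.disjoint_left]
  rintro v (hv | hv) hv' <;> rw [Tube.mem_box] at hv hv'
  · simp only [nearTubeA, spokeTubeB] at hv hv'; omega
  · simp only [spokeTubeA, spokeTubeB] at hv hv'; omega

/-! ### Catching the exit -/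

namespace TermFence

variable {M k : ℕ} {c : Finset (Site 2)} {z : Site 2} {ω : SiteConfig (Site 2)} {S : Set (Site 2)}
  (T : TermFence M c z k ω S)

/-- **A crossing of the tall catch tube meets the connection of the fence**: its lower part is a
crossing of `catchTubeA`. [cite: KestenPTM1982, §2.2] -/
theorem nearA_meets (hk : 2 ≤ k) (hz : z ∈ trapO M) (hq : triNorm T.q ≤ 2 * M) {x y : Site 2}
    (hxy : (nearTubeA M (z 1) k).IsCrossing ω x y) :
    ∃ v, v ∈ (nearTubeA M (z 1) k).box ∩ ω ∧ v ∈ T.F ∧ PathIn triGraph ((nearTubeA M (z 1) k).box ∩ ω) x v := by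
  obtain ⟨⟨hx, hy⟩, hP⟩ := hxy
  simp only [nearTubeA] at hx hy
  obtain ⟨X, hX, hPX, hstar⟩ := hP.exists_support
  -- the lower part of the crossing: rows `[z₁ + 1, z₁ + 2k + 1]`
  obtain ⟨x', y', hx', hy', hP'⟩ := hPX.exists_slab_crossing 1 (L := z 1 + 1) (R := z 1 + 2 * k + 1)
    (by omega) (by rw [hx]) (by rw [hy]; omega)
  obtain ⟨v, hvX, hvF⟩ := T.catchA_meets hk hz hq (X := X ∩ {v | z 1 + 1 ≤ v 1 ∧ v 1 ≤ z 1 + 2 * k + 1})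
    (fun w hw => by
      have h := (hX hw.1).1; rw [Tube.mem_box] at h; simp only [nearTubeA] at h
      have h2 := hw.2; simp only [Set.mem_setOf_eq] at h2
      rw [Tube.mem_box]; simp only [catchTubeA]; omega)
    hP' hx' hy'
  exact ⟨v, hX hvX.1, hvF, (hstar v hvX.1).mono hX⟩

end TermFence

namespace TermFenceT

variable {M k : ℕ} {c : Finset (Site 2)} {z : Site 2} {ω : SiteConfig (Site 2)} {S : Set (Site 2)}
  (T : TermFenceT M c z k ω S)

/-- **A crossing of the `β`-spoke meets the lower branch of the tall fence crossing**: its first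
part (columns `≤ 2M + 3k`) is a crossing of `catchTubeB` (`L ≥ 2k`, rows inside `[z₁+1, z₁+k-1]`). [cite: KestenPTM1982, §2.2] -/
theorem spokeB_meets (hk : 2 ≤ k) (hz : z ∈ trapO M) {b : ℤ} {L h : ℕ} (hL : 2 * k ≤ L) (hb : z 1 + 1 ≤ b)
    (hbh : b + h ≤ z 1 + k - 1) {x y : Site 2} (hxy : (spokeTubeB M k b L h).IsCrossing ω x y) :
    ∃ Bs : Set (Site 2), Bs ⊆ triStrip (z 0 + k) (z 1 + 1) k (2 * k - 1) ∩ ω ∧ T.m ∈ Bs ∧ (∀ w ∈ Bs, PathIn triGraph Bs T.m w) ∧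
      ∃ v, v ∈ Bs ∧ PathIn triGraph ((spokeTubeB M k b L h).box ∩ ω) x v := by
  obtain ⟨⟨hx, hy⟩, hP⟩ := hxy
  simp only [spokeTubeB] at hx hy
  obtain ⟨X, hX, hPX, hstar⟩ := hP.exists_support
  obtain ⟨x', y', hx', hy', hP'⟩ := hPX.exists_slab_crossing 0 (L := 2 * (M : ℤ) + k) (R := 2 * (M : ℤ) + 3 * k)
    (by omega) (by rw [hx]) (by rw [hy]; omega)
  obtain ⟨Bs, hBs, hmB, hst, v, hvX, hvB⟩ := T.catchB_meets hk hz (X := X ∩ {v | 2 * (M : ℤ) + k ≤ v 0 ∧ v 0 ≤ 2 * (M : ℤ) + 3 * k})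
    (fun w hw => by
      have h := (hX hw.1).1; rw [Tube.mem_box] at h; simp only [spokeTubeB] at h
      have h2 := hw.2; simp only [Set.mem_setOf_eq] at h2
      rw [Tube.mem_box]; simp only [catchTubeB]; omega)
    hP' hx' hy'
  exact ⟨Bs, hBs, hmB, hst, v, hvB, (hstar v hvX.1).mono hX⟩

end TermFenceT

/-! ### The tubes (type `B`: below the tip) -/

/-- **The tall catch tube of system `α'`** (below the tip): vertical, `[2M + 1, 2M + k - 1] × [t - 3k, t - 1]`. [cite: Nolin2008, §4.3 Prop. 12 (proof) (arXiv 0711.4948: Prop. 11)] -/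
def nearTubeA' (M : ℕ) (t : ℤ) (k : ℕ) : Tube := ⟨2 * (M : ℤ) + 1, t - 3 * k, k - 2, 3 * k - 1, false⟩

/-- The thin spoke crosses the tall catch tube below the tip, when its rows lie inside `[t - 3k, t - 1]`. [folklore] -/
theorem crosses_nearTubeA'_spokeTubeA {M : ℕ} {t b : ℤ} {k L h : ℕ} (hk : 2 ≤ k) (hL : k - 2 ≤ L)
    (hb : t - 3 * k ≤ b) (hbh : b + h ≤ t - 1) :
    Crosses (nearTubeA' M t k) (spokeTubeA M b L h) := by
  right
  refine ⟨rfl, rfl, ?_, ?_, ?_, ?_⟩ <;> simp only [nearTubeA', spokeTubeA] <;> omega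

/-- Aspect ratio of the tall catch tube below the tip (`k ≥ 4`). [folklore] -/
theorem aspectLE_nearTubeA' (M : ℕ) (t : ℤ) {k : ℕ} (hk : 4 ≤ k) : (nearTubeA' M t k).AspectLE 7 := by
  unfold AspectLE nearTubeA'; simp only [cond_false]; omega

/-- Rows of the near tubes below the tip: inside `[t - 3k, t)`, columns `> 2M`. [folklore] -/
theorem rows_near_B {M : ℕ} {t bα bβ : ℤ} {k Lα Lβ h : ℕ} (hk : 2 ≤ k)
    (hbα : t - 3 * k ≤ bα) (hbαh : bα + h ≤ t - 2 * k - 2) (hbβ : t - k + 1 ≤ bβ) (hbβh : bβ + h ≤ t - 1) {v : Site 2}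
    (hv : v ∈ (nearTubeA' M t k).box ∪ (spokeTubeA M bα Lα h).box ∪ (spokeTubeB M k bβ Lβ h).box) :
    t - 3 * k ≤ v 1 ∧ v 1 < t ∧ 2 * (M : ℤ) < v 0 := by
  rcases hv with (hv | hv) | hv <;> rw [Tube.mem_box] at hv
  · simp only [nearTubeA'] at hv; omega
  · simp only [spokeTubeA] at hv; omega
  · simp only [spokeTubeB] at hv; omega

/-- The `α'`-tubes avoid the `β'`-spoke below the tip. [folklore] -/
theorem disjoint_near_B {M : ℕ} {t bα bβ : ℤ} {k Lα Lβ h : ℕ} (hk : 2 ≤ k)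
    (hbαh : bα + h ≤ t - 2 * k - 2) (hbβ : t - k + 1 ≤ bβ) :
    Disjoint ((nearTubeA' M t k).box ∪ (spokeTubeA M bα Lα h).box) (spokeTubeB M k bβ Lβ h).box := by
  rw [Set.disjoint_left]
  rintro v (hv | hv) hv' <;> rw [Tube.mem_box] at hv hv'
  · simp only [nearTubeA', spokeTubeB] at hv hv'; omega
  · simp only [spokeTubeA, spokeTubeB] at hv hv'; omega

namespace TermFenceUp

variable {M k : ℕ} {d : Finset (Site 2)} {z : Site 2} {ω : SiteConfig (Site 2)} {S : Set (Site 2)}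
  (T : TermFenceUp M d z k ω S)

/-- **A crossing of the tall catch tube below the tip meets the connection of a fence from
above**: its upper part is a crossing of `catchTubeA'`. [cite: KestenPTM1982, §2.2] -/
theorem nearA'_meets (hk : 2 ≤ k) (hz : z ∈ trapO M) (hq : triNorm T.q ≤ 2 * M) {x y : Site 2}
    (hxy : (nearTubeA' M (z 1) k).IsCrossing ω x y) :
    ∃ v, v ∈ (nearTubeA' M (z 1) k).box ∩ ω ∧ v ∈ T.F ∧ PathIn triGraph ((nearTubeA' M (z 1) k).box ∩ ω) x v := by
  obtain ⟨⟨hx, hy⟩, hP⟩ := hxy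
  simp only [nearTubeA'] at hx hy
  obtain ⟨X, hX, hPX, hstar⟩ := hP.exists_support
  obtain ⟨x', y', hx', hy', hP'⟩ := hPX.exists_slab_crossing 1 (L := z 1 - 2 * k - 1) (R := z 1 - 1)
    (by omega) (by rw [hx]; omega) (by rw [hy]; omega)
  obtain ⟨v, hvX, hvF⟩ := T.catchA'_meets hk hz hq (X := X ∩ {v | z 1 - 2 * k - 1 ≤ v 1 ∧ v 1 ≤ z 1 - 1})
    (fun w hw => by
      have h := (hX hw.1).1; rw [Tube.mem_box] at h; simp only [nearTubeA'] at h
      have h2 := hw.2; simp only [Set.mem_setOf_eq] at h2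
      rw [Tube.mem_box]; simp only [catchTubeA']; omega)
    hP' hx' hy'
  exact ⟨v, hX hvX.1, hvF, (hstar v hvX.1).mono hX⟩

end TermFenceUp

namespace TermFenceUpT

variable {M k : ℕ} {d : Finset (Site 2)} {z : Site 2} {ω : SiteConfig (Site 2)} {S : Set (Site 2)}
  (T : TermFenceUpT M d z k ω S)

/-- **A crossing of the `β'`-spoke meets the upper branch of a tall fence crossing from above.** [cite: KestenPTM1982, §2.2] -/
theorem spokeB'_meets (hk : 2 ≤ k) (hz : z ∈ trapO M) {b : ℤ} {L h : ℕ} (hL : 2 * k ≤ L) (hb : z 1 - k + 1 ≤ b)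
    (hbh : b + h ≤ z 1 - 1) {x y : Site 2} (hxy : (spokeTubeB M k b L h).IsCrossing ω x y) :
    ∃ Bs : Set (Site 2), Bs ⊆ triStrip (z 0 + k) (z 1 - 2 * k) k (2 * k - 1) ∩ ω ∧ T.m ∈ Bs ∧ (∀ w ∈ Bs, PathIn triGraph Bs T.m w) ∧
      ∃ v, v ∈ Bs ∧ PathIn triGraph ((spokeTubeB M k b L h).box ∩ ω) x v := by
  obtain ⟨⟨hx, hy⟩, hP⟩ := hxy
  simp only [spokeTubeB] at hx hy
  obtain ⟨X, hX, hPX, hstar⟩ := hP.exists_support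
  obtain ⟨x', y', hx', hy', hP'⟩ := hPX.exists_slab_crossing 0 (L := 2 * (M : ℤ) + k) (R := 2 * (M : ℤ) + 3 * k)
    (by omega) (by rw [hx]) (by rw [hy]; omega)
  obtain ⟨Bs, hBs, hmB, hst, v, hvX, hvB⟩ := T.catchB'_meets hk hz (X := X ∩ {v | 2 * (M : ℤ) + k ≤ v 0 ∧ v 0 ≤ 2 * (M : ℤ) + 3 * k})
    (fun w hw => by
      have h := (hX hw.1).1; rw [Tube.mem_box] at h; simp only [spokeTubeB] at h
      have h2 := hw.2; simp only [Set.mem_setOf_eq] at h2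
      rw [Tube.mem_box]; simp only [catchTubeB']; omega)
    hP' hx' hy'
  exact ⟨Bs, hBs, hmB, hst, v, hvB, (hstar v hvX.1).mono hX⟩

end TermFenceUpT

end Literature.Probability.Percolation
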